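import Summits.PneNP.PneNP.Theses.ExpanderLinearGenerators
import Summits.PneNP.PneNP.Theses.MatroidTseitin

/-!
# PneNP / ExpanderLinearGenerators — boundary expansion gives Gaussian width:
`ExpansionForcesDepthFregeSize` follows from `GaussianWidthDepthFregeLB`
(stmt-PneNP-11442 ⇐ stmt-PneNP-11425, helper file)

Route `PneNP/ExpanderLinearGenerators`, support item stmt-PneNP-11442
(`Summit.PneNP.PneNP.Theses.ExpanderLinearGenerators.ExpansionForcesDepthFregeSize`, the
EXPANSION-SCALE LAW: depth-`d` Frege refutations of the XOR-CNF of an unsolvable `ℓ`-sparse system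
over `𝔽₂` whose row supports form an `(r, 3/4 · ℓ)`-boundary expander have size `≥ 2^(r^ε)`).
The sibling route `PneNP/MatroidTseitin` conjectures the GAUSSIAN-WIDTH LAW
(`Summit.PneNP.PneNP.Theses.MatroidTseitin.GaussianWidthDepthFregeLB`, item stmt-PneNP-11425):
if every symmetric-difference derivation of an odd even-cover of the rows (a row set whose sum has
zero coefficient vector and right-hand side `1`) from single rows passes through a row set whose sum
has support `≥ w`, then depth-`d` Frege refutations have size `≥ 2^(w^ε)`.

This file proves the glue between the two laws, the Ben-Sasson–Wigderson halving argument
("expansion gives width"), and records the implication `GaussianWidthDepthFregeLB →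
ExpansionForcesDepthFregeSize` (so item 11442, and with it Krajíček's Problem 19.4.5 in the form of
item stmt-PneNP-11443, is implied by item 11425):

* `fst_lincomb_indicator` — the coefficient vector of the sum of the rows in `S`.
* `boundary_subset_map_supp_lincomb` — every unique-neighbour point of `S` is in the support of the
  sum of the rows of `S` (over `𝔽₂` nothing cancels it).
* `lt_card_of_fst_lincomb_eq_zero` — under `(r, c)`-boundary expansion with `c > 0`, a nonempty
  row set whose sum has zero coefficient vector has more than `r` rows.
* `exists_half_lt_card_le_of_derivation` — in a symmetric-difference derivation from single rows
  reaching a set of size `> r/2` (`r ≥ 2`), some derived set has size in `(r/2, r]`.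
* `gaussianWidth_of_isBoundaryExpander` — hence every derivation of an odd even-cover passes
  through a row set whose sum has support `> c · r / 2`.
* `expansionForcesDepthFregeSize_of_gaussianWidthDepthFregeLB` — the implication between the two
  route statements (`w := ⌈3ℓr/8⌉₊`, `ε := ε₁/2`, `R := 8(N+1)`).

References: E. Ben-Sasson, A. Wigderson, *Short proofs are narrow — resolution made simple*,
J. ACM 48 (2001), §5–6 [BenSassonWigderson2001]; E. Ben-Sasson, R. Impagliazzo, *Random CNF's are
hard for the polynomial calculus*, Comput. Complexity 19 (2010) (Gaussian width); J. Krajíček,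
*Proof Complexity* (CUP 2019), Lemma 13.4.5 [KrajicekProofComplexity2019].
-/

namespace Summit.PneNP.PneNP.Theorems

set_option linter.dupNamespace false -- `Summit.PneNP.PneNP.…`: summit = sub-problem (D-0017)

open Finset Literature.Computability.MetaComplexity Literature.Computability.Complexity

/-! ### The sum of a set of rows over `𝔽₂` -/

/-- The coefficient vector of the sum `Σ_{i ∈ S} E_i` (the linear combination with the indicator
of `S` as coefficients) is the sum of the coefficient vectors of the rows in `S`. [folklore] -/
theorem fst_lincomb_indicator {m n : ℕ} (E : Fin m → LinEqMod 2 n) (S : Finset (Fin m))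
    (j : Fin n) :
    (lincomb (fun e => if e ∈ S then (1 : ZMod 2) else 0) E).1 j = ∑ i ∈ S, (E i).1 j := by
  simp only [lincomb, ite_mul, one_mul, zero_mul]
  rw [Finset.sum_ite_mem, Finset.univ_inter]

/-- The right-hand side of the sum `Σ_{i ∈ S} E_i` is the sum of the right-hand sides.
[folklore] -/
theorem snd_lincomb_indicator {m n : ℕ} (E : Fin m → LinEqMod 2 n) (S : Finset (Fin m)) :
    (lincomb (fun e => if e ∈ S then (1 : ZMod 2) else 0) E).2 = ∑ i ∈ S, (E i).2 := by
  simp only [lincomb, ite_mul, one_mul, zero_mul]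
  rw [Finset.sum_ite_mem, Finset.univ_inter]

/-- Membership in the support of an equation. [folklore] -/
theorem mem_supp_iff_fst_ne_zero {p n : ℕ} (E : LinEqMod p n) (j : Fin n) :
    j ∈ E.supp ↔ E.1 j ≠ 0 := by
  simp [LinEqMod.supp]

/-- A point of the scope family `i ↦ supp(E_i)` (read in `ℕ`) lies in the scope of row `i` iff it
is the value of a variable in the support of `E_i`. [folklore] -/
theorem val_mem_map_supp_iff {p n : ℕ} (E : LinEqMod p n) (j : Fin n) :
    (j : ℕ) ∈ E.supp.map Fin.valEmbedding ↔ j ∈ E.supp :=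
  Finset.mem_map' Fin.valEmbedding

/-- **No cancellation at unique neighbours.** Every boundary (unique-neighbour) point of a row set
`S` of a system over `𝔽₂` is (the value of) a variable in the support of the sum of the rows of
`S`. [folklore] -/
theorem boundary_subset_map_supp_lincomb {m n : ℕ} (E : Fin m → LinEqMod 2 n)
    (S : Finset (Fin m)) :
    boundary (fun i => (E i).supp.map Fin.valEmbedding) S ⊆
      (lincomb (fun e => if e ∈ S then (1 : ZMod 2) else 0) E).supp.map Fin.valEmbedding := by
  intro v hv
  rw [mem_boundary] at hv
  obtain ⟨hcov, hdeg⟩ := hv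
  obtain ⟨i, hiS, hvi⟩ := mem_cover.1 hcov
  obtain ⟨j, hj, rfl⟩ := Finset.mem_map.1 hvi
  -- `i` is the only row of `S` containing the variable `j`
  have hfilter : S.filter (fun i' => ((j : ℕ)) ∈ (E i').supp.map Fin.valEmbedding) = {i} := by
    obtain ⟨a, ha⟩ := Finset.card_eq_one.1 hdeg
    have hi : i ∈ S.filter (fun i' => ((j : ℕ)) ∈ (E i').supp.map Fin.valEmbedding) :=
      Finset.mem_filter.2 ⟨hiS, hvi⟩
    change S.filter (fun i' => ((j : ℕ)) ∈ (E i').supp.map Fin.valEmbedding) = {a} at ha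
    rw [ha] at hi ⊢
    rw [Finset.mem_singleton.1 hi]
  have hsum : (lincomb (fun e => if e ∈ S then (1 : ZMod 2) else 0) E).1 j = (E i).1 j := by
    rw [fst_lincomb_indicator, ← Finset.sum_filter_add_sum_filter_not S
      (fun i' => ((j : ℕ)) ∈ (E i').supp.map Fin.valEmbedding), hfilter, Finset.sum_singleton]
    have hzero : ∑ i' ∈ S.filter (fun i' => ¬ ((j : ℕ)) ∈ (E i').supp.map Fin.valEmbedding),
        (E i').1 j = 0 := by
      refine Finset.sum_eq_zero fun i' hi' => ?_
      have h := (Finset.mem_filter.1 hi').2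
      rw [val_mem_map_supp_iff, mem_supp_iff_fst_ne_zero, not_not] at h
      exact h
    rw [hzero, add_zero]
  have hj' : (E i).1 j ≠ 0 := (mem_supp_iff_fst_ne_zero _ _).1 hj
  exact Finset.mem_map_of_mem _ ((mem_supp_iff_fst_ne_zero _ _).2 (hsum ▸ hj'))

/-- Hence the boundary of a row set is at most as large as the support of the sum of its rows.
[folklore] -/
theorem card_boundary_le_card_supp_lincomb {m n : ℕ} (E : Fin m → LinEqMod 2 n)
    (S : Finset (Fin m)) :
    (boundary (fun i => (E i).supp.map Fin.valEmbedding) S).card ≤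
      (lincomb (fun e => if e ∈ S then (1 : ZMod 2) else 0) E).supp.card := by
  simpa only [Finset.card_map] using Finset.card_le_card (boundary_subset_map_supp_lincomb E S)

/-- **Dependencies are large.** If the row supports form an `(r, c)`-boundary expander with
`c > 0`, then a nonempty row set whose sum has zero coefficient vector has more than `r` rows.
[cite: BenSassonWigderson2001, §5] -/
theorem lt_card_of_fst_lincomb_eq_zero {m n : ℕ} (E : Fin m → LinEqMod 2 n) {r c : ℝ}
    (hc : 0 < c) (hexp : IsBoundaryExpander (fun i => (E i).supp.map Fin.valEmbedding) r c)
    (S : Finset (Fin m)) (hS : S.Nonempty)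
    (h0 : (lincomb (fun e => if e ∈ S then (1 : ZMod 2) else 0) E).1 = 0) :
    r < S.card := by
  by_contra hle
  push Not at hle
  have h1 := hexp S hle
  have h2 : (lincomb (fun e => if e ∈ S then (1 : ZMod 2) else 0) E).supp = ∅ := by
    ext j
    simp [mem_supp_iff_fst_ne_zero, h0]
  have h3 := card_boundary_le_card_supp_lincomb E S
  rw [h2, Finset.card_empty, Nat.le_zero, Finset.card_eq_zero] at h3
  rw [h3, Finset.card_empty, Nat.cast_zero] at h1
  have h4 : (0 : ℝ) < S.card := by exact_mod_cast hS.card_pos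
  nlinarith

/-! ### The halving argument -/

/-- **Halving.** In a symmetric-difference derivation `S₀, …, S_t` from single rows (every `S_i` is
a singleton or the symmetric difference of two earlier sets), if some set has more than `r/2`
elements (`r ≥ 2`), then some set has between `r/2` (excluded) and `r` (included) elements: the
first set exceeding `r/2` is the symmetric difference of two sets of size `≤ r/2`.
[cite: BenSassonWigderson2001, §5] -/
theorem exists_half_lt_card_le_of_derivation {m t : ℕ} (S : Fin (t + 1) → Finset (Fin m))
    (hS : ∀ i, (∃ e, S i = {e}) ∨ (∃ j k, j < i ∧ k < i ∧ S i = symmDiff (S j) (S k)))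
    {r : ℝ} (hr : 2 ≤ r) (i₀ : Fin (t + 1)) (hi₀ : r / 2 < (S i₀).card) :
    ∃ i, r / 2 < ((S i).card : ℝ) ∧ ((S i).card : ℝ) ≤ r := by
  classical
  set U : Finset (Fin (t + 1)) := Finset.univ.filter fun i => r / 2 < ((S i).card : ℝ) with hU
  have hU0 : U.Nonempty := ⟨i₀, by simp [hU, hi₀]⟩
  set i := U.min' hU0 with hi
  have hiU : i ∈ U := Finset.min'_mem U hU0
  have hilarge : r / 2 < ((S i).card : ℝ) := by simpa [hU] using hiU
  refine ⟨i, hilarge, ?_⟩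
  -- sets derived before `i` are small
  have hsmall : ∀ j, j < i → ((S j).card : ℝ) ≤ r / 2 := by
    intro j hj
    by_contra hlt
    push Not at hlt
    have hjU : j ∈ U := by simp [hU, hlt]
    exact absurd (Finset.min'_le U j hjU) (by rw [← hi]; exact not_le.2 hj)
  rcases hS i with ⟨e, he⟩ | ⟨j, k, hj, hk, hjk⟩
  · -- a singleton cannot exceed `r / 2 ≥ 1`
    rw [he, Finset.card_singleton, Nat.cast_one] at hilarge
    linarith
  · have hsub : S i ⊆ S j ∪ S k := by
      rw [hjk]
      exact symmDiff_subset_union  -- placeholder name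
    calc ((S i).card : ℝ) ≤ ((S j ∪ S k).card : ℝ) := by exact_mod_cast Finset.card_le_card hsub
      _ ≤ (S j).card + (S k).card := by exact_mod_cast Finset.card_union_le _ _
      _ ≤ r / 2 + r / 2 := add_le_add (hsmall j hj) (hsmall k hk)
      _ = r := by ring

/-- **Boundary expansion gives Gaussian width** (Ben-Sasson–Wigderson). If the row supports of a
system `E` over `𝔽₂` form an `(r, c)`-boundary expander with `c > 0` and `r ≥ 2`, then every
symmetric-difference derivation from single rows of an odd even-cover (a row set whose sum has zero
coefficient vector and right-hand side `1`) passes through a row set whose sum has support of size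
`> c · r / 2`: the final set is a nonempty dependency, hence has `> r` rows
(`lt_card_of_fst_lincomb_eq_zero`); the first derived set with `> r/2` rows has `≤ r` rows
(`exists_half_lt_card_le_of_derivation`), so expansion gives it `> c · r / 2` unique neighbours, none
of which cancels in its sum (`card_boundary_le_card_supp_lincomb`).
[cite: BenSassonWigderson2001, §5–6] -/
theorem gaussianWidth_of_isBoundaryExpander {m n : ℕ} (E : Fin m → LinEqMod 2 n) {r c : ℝ}
    (hc : 0 < c) (hr : 2 ≤ r)
    (hexp : IsBoundaryExpander (fun i => (E i).supp.map Fin.valEmbedding) r c)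
    {t : ℕ} (S : Fin (t + 1) → Finset (Fin m))
    (hS : ∀ i, (∃ e, S i = {e}) ∨ (∃ j k, j < i ∧ k < i ∧ S i = symmDiff (S j) (S k)))
    (h0 : (lincomb (fun e => if e ∈ S (Fin.last t) then (1 : ZMod 2) else 0) E).1 = 0)
    (h1 : (lincomb (fun e => if e ∈ S (Fin.last t) then (1 : ZMod 2) else 0) E).2 = 1) :
    ∃ i, c * r / 2 <
      ((lincomb (fun e => if e ∈ S i then (1 : ZMod 2) else 0) E).supp.card : ℝ) := by
  -- the final set is nonempty (its sum has right-hand side `1`) ...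
  have hne : (S (Fin.last t)).Nonempty := by
    rw [Finset.nonempty_iff_ne_empty]
    intro hempty
    rw [snd_lincomb_indicator, hempty, Finset.sum_empty] at h1
    exact zero_ne_one h1
  -- ... hence a dependency of more than `r` rows
  have hlast : r < (S (Fin.last t)).card := lt_card_of_fst_lincomb_eq_zero E hc hexp _ hne h0
  have hhalf : r / 2 < ((S (Fin.last t)).card : ℝ) := by linarith
  obtain ⟨i, hlo, hhi⟩ := exists_half_lt_card_le_of_derivation S hS hr (Fin.last t) hhalf
  refine ⟨i, ?_⟩
  have hbd := hexp (S i) hhi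
  have hsupp := card_boundary_le_card_supp_lincomb E (S i)
  calc c * r / 2 = c * (r / 2) := by ring
    _ < c * (S i).card := mul_lt_mul_of_pos_left hlo hc
    _ ≤ (boundary (fun i => (E i).supp.map Fin.valEmbedding) (S i)).card := hbd
    _ ≤ _ := by exact_mod_cast hsupp

/-! ### The implication between the two route statements -/

/-- Real bookkeeping for the exponents: for `r ≥ 8` and `ε ≥ 0`, `r ^ (ε / 2) ≤ (3r/8) ^ ε`
(since `√r ≤ 3r/8`). [folklore] -/
theorem rpow_half_le_rpow_of_eight_le {r ε : ℝ} (hr : 8 ≤ r) (hε : 0 ≤ ε) {w : ℝ}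
    (hw : 3 * r / 8 ≤ w) : r ^ (ε / 2) ≤ w ^ ε := by
  have hr0 : 0 ≤ r := by linarith
  have hsqrt : (8 / 3 : ℝ) ≤ Real.sqrt r := by
    apply Real.le_sqrt_of_sq_le
    nlinarith
  have hle : Real.sqrt r ≤ w := by
    have h := Real.mul_self_sqrt hr0
    nlinarith [Real.sqrt_nonneg r]
  calc r ^ (ε / 2) = (r ^ (1 / 2 : ℝ)) ^ ε := by
        rw [← Real.rpow_mul hr0]; ring_nf
    _ = Real.sqrt r ^ ε := by rw [Real.sqrt_eq_rpow]
    _ ≤ w ^ ε := Real.rpow_le_rpow (Real.sqrt_nonneg r) hle hε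

open Summit.PneNP.PneNP.Theses in
/-- **`GaussianWidthDepthFregeLB → ExpansionForcesDepthFregeSize`** (item stmt-PneNP-11442 of route
`ExpanderLinearGenerators` follows from item stmt-PneNP-11425 of route `MatroidTseitin`). Given the
Gaussian-width law with constants `ε₁, N` for `(ℓ, d)`, the expansion-scale law holds with
`ε := ε₁ / 2` and `R := 8 (N + 1)`: for an `(r, 3/4 · ℓ)`-boundary expander every derivation of an
odd even-cover passes through a sum of support `> 3ℓr/8` (`gaussianWidth_of_isBoundaryExpander`),
so the system has Gaussian width `≥ w := ⌈3ℓr/8⌉₊ ≥ 3r/8 ≥ N`, and `2^(r^(ε₁/2)) ≤ 2^(w^ε₁)`.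
The unsolvability hypothesis is not needed. [cite: BenSassonWigderson2001, §5–6] -/
theorem expansionForcesDepthFregeSize_of_gaussianWidthDepthFregeLB
    (h : MatroidTseitin.GaussianWidthDepthFregeLB) :
    ExpanderLinearGenerators.ExpansionForcesDepthFregeSize := by
  intro ℓ d hℓ
  obtain ⟨ε, hε, N, hN⟩ := h ℓ d
  refine ⟨ε / 2, half_pos hε, 8 * (N + 1), fun r hr n m E hsparse hexp _hunsat π hπ => ?_⟩
  have hN0 : (0 : ℝ) ≤ N := Nat.cast_nonneg N
  have hr8 : (8 : ℝ) ≤ r := by nlinarith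
  have hr2 : (2 : ℝ) ≤ r := by linarith
  have hℓ1 : (1 : ℝ) ≤ ℓ := by exact_mod_cast hℓ
  have hc : (0 : ℝ) < 3 / 4 * ℓ := by positivity
  -- the width parameter
  set w : ℕ := ⌈3 / 4 * (ℓ : ℝ) * r / 2⌉₊ with hw
  have hw_ge : 3 * r / 8 ≤ (w : ℝ) := by
    calc 3 * r / 8 ≤ 3 / 4 * (ℓ : ℝ) * r / 2 := by nlinarith
      _ ≤ (w : ℝ) := Nat.le_ceil _
  have hNw : N ≤ w := by
    have : (N : ℝ) ≤ (w : ℝ) := by nlinarith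
    exact_mod_cast this
  -- Gaussian width `≥ w` from expansion
  have hgw : ∀ (t : ℕ) (S : Fin (t + 1) → Finset (Fin m)),
      (∀ i, (∃ e, S i = {e}) ∨ (∃ j k, j < i ∧ k < i ∧ S i = symmDiff (S j) (S k))) →
      (lincomb (fun e => if e ∈ S (Fin.last t) then (1 : ZMod 2) else 0) E).1 = 0 →
      (lincomb (fun e => if e ∈ S (Fin.last t) then (1 : ZMod 2) else 0) E).2 = 1 →
      ∃ i, w ≤ (lincomb (fun e => if e ∈ S i then (1 : ZMod 2) else 0) E).supp.card := by
    intro t S hS h0 h1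
    obtain ⟨i, hi⟩ := gaussianWidth_of_isBoundaryExpander E hc hr2 hexp S hS h0 h1
    exact ⟨i, Nat.ceil_le.2 hi.le⟩
  have key : (2 : ℝ) ^ ((w : ℝ) ^ ε) ≤ (proofSize π : ℝ) := hN m n w E hsparse hNw hgw π hπ
  calc (2 : ℝ) ^ (r ^ (ε / 2)) ≤ (2 : ℝ) ^ ((w : ℝ) ^ ε) :=
        Real.rpow_le_rpow_of_exponent_le (by norm_num)
          (rpow_half_le_rpow_of_eight_le hr8 hε.le hw_ge)
    _ ≤ (proofSize π : ℝ) := key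

end Summit.PneNP.PneNP.Theorems
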